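/-
Origin: expansion seat `planner-pub-hodgecm-pohl-g15-0`, handover #3 2026-08-18T16:19:39Z (md5 80f4f97b703c1b6ade33ead1752da054, 193 l.; RUN-32 CANDIDATE ROW, ON REQUEST ONLY — TREE-SHAPE SPLIT (≤400 l.) of the pohl lineage, source lines verbatim; NEW first part; lands AFTER — (imports PKG WeightLines + StubTree.Qw8Geometric); no import rewrite) (`HOME/pub-hodgecm-pohl-g15/lean/Pohl15/DegreeZeroTop.lean`, md5 80f4f97b, 193 lines);
landed by the packager successor (mc-unitary-1-g3, gen-8 kit) in gate run 32 as `HodgeCM/Proofs/Pohlmann/DegreeZeroTop.lean` (verbatim).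
-/
/-
Copyright: pub-hodgecm formalisation cell (harness21, 2026). New file (not vendored).
Origin: HOME/pub-hodgecm-pohl-g15/lean/Pohl15/DegreeZeroTop.lean — session planner-pub-hodgecm-pohl-g15-0 (unit pub-hodgecm-pohl-g15),
EXPANSION part (b) `PohlmannSpan`, generation 15: TREE-SHAPE STAGING under the 400-line rule of lean/CONVENTIONS.md §2 — part 1/2
of the split of `HodgeCM/Proofs/Pohlmann/DegreeZero.lean` (pohl-g5, gate run 23; 414 l., md5 a548fabfc31b): source lines 60–225 VERBATIM; the module docstring below is new (it only describes the cut).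
Intended final place: `HodgeCM/Proofs/Pohlmann/DegreeZeroTop.lean` (module `HodgeCM.Proofs.Pohlmann.DegreeZeroTop`); imports final (certified package modules only).
-/
import Summits.HodgeConjecture.HodgeCM.Proofs.Pohlmann.WeightLines
import Summits.HodgeConjecture.HodgeCM.StubTree.Qw8Geometric

/-!
# Pohlmann's theorem in degree zero, I: `dim_ℂ H⁰(A′, ℂ) ≤ 1`, the top degree, `H⁰(A′)` is a line

First half of the former `DegreeZero.lean` (pohl-g5), split at its section boundary `end DegreeZero` under the tree's 400-line
rule (lean/CONVENTIONS.md §2); every declaration below is the source's, verbatim.  Contents (`section DegreeZero`): nonempty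
weights have no weight vectors in degree `0` and `dim_ℂ H⁰(A′, ℂ) ≤ 1` (M + N1 + N3); the top degree `2·dim A′ = (n+1)[F:ℚ]`
and `H⁰(A′) ≠ 0` via F6 `Fact_weightDual`; `finrank_cohC_zero` / `finrank_coh_zero_cmProd` (`dim H⁰(A′) = 1`).
The named statement `CMProdConnected`, the all-degree line count, codimension `0` and Gao–Ullmo Thm 3.1 for every `p ≥ 0`
(`PohlmannTheorem31All`) are in `DegreeZero.lean`, which imports this file and keeps the module name.
-/

noncomputable section

open scoped TensorProduct NumberField

namespace HodgeCM

namespace Universe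

open Literature.AlgebraicGeometry.Motives (CMType)

variable {U : Universe}

/-! ## Degree zero: nonempty weights have no weight vectors; `dim_ℂ H⁰(A′, ℂ) ≤ 1` -/

section DegreeZero

variable {F : CMField} {n : ℕ} {Θ : Fin (n + 1) → CMType F}

/-- In degree `0` a weight with a nonempty component has no nonzero weight vector: the factor-wise CM multiplication
by `2 ∈ 𝓞_F` on the `j₀`-th factor (`exists_isFactorAct`, M1 + M18 + M24) acts trivially on `H⁰(A′)` (N3 `Fact_pull_H0`) and
by `∏_{s ∈ S_{j₀}} s(2) = 2^{|S_{j₀}|} ≠ 1` on `V_S` (the degree-`0` half of pohl-g2's `weightSpace_le_piece_zero`). -/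
theorem weightSpace_zero_eq_bot (M : U.ModelAxioms) (hN3 : U.Fact_pull_H0)
    {S : Fin (n + 1) → Finset ((F : Type) →+* ℂ)} {j₀ : Fin (n + 1)} (hj₀ : (S j₀).Nonempty) :
    U.weightSpace F Θ S 0 = ⊥ := by
  rw [eq_bot_iff]
  intro z hz
  obtain ⟨Ma, hMa⟩ := exists_isFactorAct M F Θ j₀ 2
  have h1 := (mem_weightSpace_iff _ _ _ _ _).1 hz j₀ _ Ma hMa
  have h2 : U.pullC Ma 0 z = z := by
    show (U.pull Ma 0).baseChange ℂ z = z
    rw [hN3, LinearMap.baseChange_id]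
    rfl
  have h3 : (∏ s ∈ S j₀, s ((2 : 𝓞 F) : F)) = (2 : ℂ) ^ (S j₀).card := by
    rw [← Finset.prod_const]
    refine Finset.prod_congr rfl fun s _ => ?_
    rw [NumberField.RingOfIntegers.coe_eq_algebraMap, map_ofNat, map_ofNat]
  rw [h2, h3] at h1
  have hm : (2 : ℂ) ^ (S j₀).card ≠ 1 := by
    have hc : (S j₀).card ≠ 0 := Finset.card_ne_zero.2 hj₀
    exact_mod_cast (Nat.one_lt_two_pow_iff.2 hc).ne'
  have h4 : ((2 : ℂ) ^ (S j₀).card - 1) • z = 0 := by rw [sub_smul, one_smul, ← h1, sub_self]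
  rw [Submodule.mem_bot]
  exact (smul_eq_zero.1 h4).resolve_left (sub_ne_zero.2 hm)

/-- `dim_ℂ V_S ≤ 1` in EVERY degree, for a weight with a nonempty component (positive degree: pohl-g3
`finrank_weightSpace_le_one`, from `ModelAxioms` + N1; degree `0`: `V_S = 0`, from `ModelAxioms` + N3). -/
theorem finrank_weightSpace_le_one_of_nonempty (M : U.ModelAxioms) (hN1 : U.Fact_cupExterior) (hN3 : U.Fact_pull_H0)
    (m : ℕ) {S : Fin (n + 1) → Finset ((F : Type) →+* ℂ)} {j₀ : Fin (n + 1)} (hj₀ : (S j₀).Nonempty) :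
    Module.finrank ℂ (U.weightSpace F Θ S m) ≤ 1 := by
  rcases Nat.eq_zero_or_pos m with rfl | hm
  · rw [weightSpace_zero_eq_bot M hN3 hj₀, finrank_bot]
    exact Nat.zero_le _
  · exact finrank_weightSpace_le_one M hN1 hm S

/-- **`dim_ℂ H⁰(A′, ℂ) ≤ 1`** (`ModelAxioms` + N1 + N3 + F6).  Every class `y` of `H⁰(A′) ⊗ ℂ` has the empty weight (N3);
if `y ≠ 0`, F6 (with `q = 0`) provides a weight vector `w'` of the complementary, i.e. FULL, weight in degree `2·dim A′` with
`∫ w' ∪ y ≠ 0`.  Hence `y ↦ (w ↦ ∫ w ∪ y)` maps `H⁰ ⊗ ℂ` injectively to the dual of the full-weight space of degree `2·dim A′`,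
whose dimension is `≤ 1` (`finrank_weightSpace_le_one_of_nonempty`). -/
theorem finrank_cohC_zero_le_one (M : U.ModelAxioms) (hN1 : U.Fact_cupExterior) (hN3 : U.Fact_pull_H0)
    (h6 : U.Fact_weightDual) : Module.finrank ℂ (U.CohC (U.cmProd F Θ) 0) ≤ 1 := by
  let W : Submodule ℂ (U.CohC (U.cmProd F Θ) (2 * (U.dim (U.cmProd F Θ) - 0))) :=
    U.weightSpace F Θ (fun _ => Finset.univ) (2 * (U.dim (U.cmProd F Θ) - 0))
  let B : U.CohC (U.cmProd F Θ) (2 * (U.dim (U.cmProd F Θ) - 0)) →ₗ[ℂ] U.CohC (U.cmProd F Θ) (2 * 0) →ₗ[ℂ] ℂ :=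
    (U.cupC (U.cmProd F Θ) (2 * (U.dim (U.cmProd F Θ) - 0)) (2 * 0)).compr₂ (U.trC (U.cmProd F Θ) _)
  let ψ : U.CohC (U.cmProd F Θ) (2 * 0) →ₗ[ℂ] Module.Dual ℂ W := W.subtype.dualMap ∘ₗ B.flip
  have hψ : Function.Injective ψ := by
    refine (injective_iff_map_eq_zero ψ).2 fun y hy => ?_
    by_contra hy0
    obtain ⟨-, w', hw', h1, -⟩ := h6 F n Θ 0 (fun _ => ∅) y hy0 (isWeightVector_zero hN3 y)
    have hw'' : w' ∈ W := by
      rw [mem_weightSpace_iff]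
      simpa only [Finset.compl_empty] using hw'
    have hval : ψ y ⟨w', hw''⟩ = U.trC (U.cmProd F Θ) _ (U.cupC (U.cmProd F Θ) _ _ w' y) := rfl
    rw [hy, LinearMap.zero_apply] at hval
    exact h1 hval.symm
  calc Module.finrank ℂ (U.CohC (U.cmProd F Θ) 0)
      = Module.finrank ℂ (U.CohC (U.cmProd F Θ) (2 * 0)) := rfl
    _ ≤ Module.finrank ℂ (Module.Dual ℂ W) := LinearMap.finrank_le_finrank_of_injective hψ
    _ = Module.finrank ℂ W := Subspace.dual_finrank_eq
    _ ≤ 1 := finrank_weightSpace_le_one_of_nonempty M hN1 hN3 _ (j₀ := 0) Finset.univ_nonempty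

/-! ## The top degree: `2 · dim A′ = (n+1)[F:ℚ]` and `H⁰(A′) ≠ 0` -/

/-- **`2 · dim A′ = (n + 1)·[F:ℚ]` and `H⁰(A′, ℂ) ≠ 0`** (`ModelAxioms` + N1 + F6).  With `N = dim_ℚ H¹(A′, ℚ) = (n+1)[F:ℚ]`
(M21, M22) — even, `F` being totally complex, say `N = 2q`, and positive: by N1 `dim_ℂ H^N(A′, ℂ) = C(N, N) = 1`, so some
weight space of degree `N` is nonzero, necessarily of a weight `S` with `Σ_j |S_j| = N`, i.e. `Σ_j |S_jᶜ| = 0` (pohl-g3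
`finrank_weightSpace`); F6 gives `q ≤ dim A′` and a nonzero weight vector of weight `(S_jᶜ)_j` in degree `2(dim A′ - q)`, which
forces `2(dim A′ - q) = 0` (positive-degree weight spaces of total weight `≠` the degree vanish). -/
theorem two_mul_dim_cmProd_and_nontrivial (M : U.ModelAxioms) (hN1 : U.Fact_cupExterior) (h6 : U.Fact_weightDual) :
    2 * U.dim (U.cmProd F Θ) = (n + 1) * Module.finrank ℚ F ∧ Nontrivial (U.CohC (U.cmProd F Θ) 0) := by
  classical
  obtain ⟨N, hN⟩ : ∃ N, (n + 1) * Module.finrank ℚ F = N := ⟨_, rfl⟩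
  have hNpos : 0 < N := hN ▸ Nat.mul_pos (Nat.succ_pos n) Module.finrank_pos
  obtain ⟨q, hq⟩ : ∃ q, N = 2 * q :=
    ⟨(n + 1) * NumberField.InfinitePlace.nrComplexPlaces F, by
      rw [← hN, NumberField.IsTotallyComplex.finrank (K := (F : Type))]; ring⟩
  obtain ⟨k, hk⟩ : ∃ k, N = k + 1 := ⟨N - 1, by omega⟩
  -- `dim_ℂ H^{k+1}(A′, ℂ) = C(N, N) = 1`
  have hE := hN1 F n Θ k
  have hdim : Module.finrank ℂ (U.CohC (U.cmProd F Θ) (k + 1)) = 1 := by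
    rw [finrank_cohC_succ hE, finrank_coh_one_cmProd M F Θ, hN, hk, Nat.choose_self]
  -- some weight space of degree `k + 1` is nonzero
  obtain ⟨S, hS⟩ : ∃ S : Fin (n + 1) → Finset ((F : Type) →+* ℂ), U.weightSpace F Θ S (k + 1) ≠ ⊥ := by
    by_contra h
    push Not at h
    have htop := iSup_weightSpace_succ (F := F) (Θ := Θ) M hN1 k
    rw [iSup_eq_bot.2 h] at htop
    have h0 : Module.finrank ℂ (U.CohC (U.cmProd F Θ) (k + 1)) = 0 := by
      rw [← finrank_top, ← htop, finrank_bot]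
    omega
  -- its weight has total size `k + 1 = N`, so the complementary weight has total size `0`
  have hsum : (∑ j, (S j).card) = k + 1 := by
    by_contra hne
    exact hS (weightSpace_eq_bot_of_sum_card_ne M hN1 (Nat.succ_pos k) hne)
  have hcompl : (∑ j, ((S j)ᶜ).card) = 0 := by
    have htot : (∑ j : Fin (n + 1), ((S j).card + ((S j)ᶜ).card)) = (n + 1) * Module.finrank ℚ F := by
      rw [Finset.sum_congr rfl fun j _ => Finset.card_add_card_compl (S j), Finset.sum_const, Finset.card_univ,
        Fintype.card_fin, smul_eq_mul, NumberField.Embeddings.card]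
    rw [Finset.sum_add_distrib, hsum] at htot
    omega
  -- a nonzero weight vector of weight `S` in degree `2q`
  obtain ⟨z, hzS, hz0⟩ := Submodule.exists_mem_ne_zero_of_ne_bot hS
  have hk2 : k + 1 = 2 * q := by omega
  have hz' : U.IsWeightVector F Θ S (2 * q) (U.castC _ hk2 z) :=
    U.isWeightVector_castC F Θ S hk2 ((mem_weightSpace_iff _ _ _ _ _).1 hzS)
  have hz0' : U.castC (U.cmProd F Θ) hk2 z ≠ 0 := fun h => hz0 ((LinearEquiv.map_eq_zero_iff _).1 h)
  -- F6: `q ≤ dim A′` and a partner of the complementary weight in degree `2 (dim A′ - q)`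
  obtain ⟨hqd, w', hw', h1, -⟩ := h6 F n Θ q S _ hz0' hz'
  have hw'0 : w' ≠ 0 := by
    rintro rfl
    exact h1 (by simp)
  -- that degree must be `0`
  have hdq : 2 * (U.dim (U.cmProd F Θ) - q) = 0 := by
    by_contra hne
    have hpos : 0 < 2 * (U.dim (U.cmProd F Θ) - q) := Nat.pos_of_ne_zero hne
    have hne' : (∑ j, ((S j)ᶜ).card) ≠ 2 * (U.dim (U.cmProd F Θ) - q) := by
      rw [hcompl]; exact fun h => hne h.symm
    have hbot : U.weightSpace F Θ (fun i => (S i)ᶜ) (2 * (U.dim (U.cmProd F Θ) - q)) = ⊥ :=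
      weightSpace_eq_bot_of_sum_card_ne M hN1 hpos hne'
    have hmem : w' ∈ U.weightSpace F Θ (fun i => (S i)ᶜ) (2 * (U.dim (U.cmProd F Θ) - q)) :=
      (mem_weightSpace_iff _ _ _ _ _).2 hw'
    rw [hbot, Submodule.mem_bot] at hmem
    exact hw'0 hmem
  refine ⟨by omega, ?_⟩
  have hw0 : U.castC (U.cmProd F Θ) hdq w' ≠ 0 := fun h => hw'0 ((LinearEquiv.map_eq_zero_iff _).1 h)
  exact nontrivial_of_ne _ _ hw0

/-- **`2 · dim A′ = (n + 1)·[F:ℚ]`** for `A′ = ∏_{j ≤ n} A_{(F,Θ_j)}` (`ModelAxioms` + N1 + F6; the dimension half of M10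
`Fact_cmAV` summed over the factors, here DERIVED for the product). -/
theorem two_mul_dim_cmProd (M : U.ModelAxioms) (hN1 : U.Fact_cupExterior) (h6 : U.Fact_weightDual) :
    2 * U.dim (U.cmProd F Θ) = (n + 1) * Module.finrank ℚ F :=
  (two_mul_dim_cmProd_and_nontrivial M hN1 h6).1

/-- **`dim_ℂ H⁰(A′, ℂ) = 1`** (`ModelAxioms` + N1 + N3 + F6). -/
theorem finrank_cohC_zero (M : U.ModelAxioms) (hN1 : U.Fact_cupExterior) (hN3 : U.Fact_pull_H0)
    (h6 : U.Fact_weightDual) : Module.finrank ℂ (U.CohC (U.cmProd F Θ) 0) = 1 := by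
  haveI := (two_mul_dim_cmProd_and_nontrivial (F := F) (Θ := Θ) M hN1 h6).2
  exact le_antisymm (finrank_cohC_zero_le_one M hN1 hN3 h6) Module.finrank_pos

/-- **`dim_ℚ H⁰(A′, ℚ) = 1`**: the CM products `A′ = ∏_{j ≤ n} A_{(F,Θ_j)}` are connected (`ModelAxioms` + N1 + N3 + F6). -/
theorem finrank_coh_zero_cmProd (M : U.ModelAxioms) (hN1 : U.Fact_cupExterior) (hN3 : U.Fact_pull_H0)
    (h6 : U.Fact_weightDual) : Module.finrank ℚ (U.Coh (U.cmProd F Θ) 0) = 1 := by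
  have h := finrank_cohC_zero (F := F) (Θ := Θ) M hN1 hN3 h6
  rwa [Module.finrank_baseChange] at h

end DegreeZero

end Universe

end HodgeCM

end
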